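import Mathlib
import Literature.Analysis.Pluripotential.VesentiniProofs
import Literature.Analysis.Matrix.ExpSpectralMapping
import HarnessLib

/-!
# The spectral abscissa of an affine matrix pencil is superharmonic

Topic `Literature/Analysis/Matrix`. For complex square matrices `A, B` and a holomorphic scalar
function `g`, the function `z ↦ log ρ(exp(-(A + g(z) B)))` is subharmonic (Vesentini's theorem,
Ransford 1995 Thm. 6.4.2, `Ransford1995_thm_6_4_2_holds`, applied to the entire Banach-algebra
valued map), and it equals minus the spectral abscissa `min {Re λ : λ ∈ σ(A + g(z) B)}`:
`log ρ(e^{-T}) = -min Re σ(T)` by the two inclusions of the spectral mapping theorem for the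
matrix exponential (`spectrum.exp_mem_exp`, `spectrum_exp_subset_exp_spectrum`). We record the
subharmonicity and the two resulting comparison lemmas; the superharmonic function
`a(z) = min Re σ(A + zB)` is the object of Ransford §6.4 / Kato's reduction of the Kramers–Kronig
floor of route `HubbardSuperconductivity/KkFloor` (`KkFloorTheorem`). No definitions.
-/

noncomputable section

open scoped Matrix.Norms.L2Operator ENNReal

namespace Literature.Analysis.Matrix

open Literature.Analysis.Pluripotential

variable {m : Type*} [Fintype m] [DecidableEq m]

/-- **Subharmonicity of `z ↦ log ρ(exp(-(A + g(z) B)))`** on any open set where the scalar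
reparametrisation `g` is holomorphic (Vesentini's theorem for the entire map
`w ↦ exp(-(A + wB))` composed with `g`). [cite: Ransford1995, Thm 6.4.2] -/
theorem isSubharmonicOn_log_spectralRadius_exp_pencil (A B : Matrix m m ℂ) {U : Set ℂ}
    (hU : IsOpen U) {g : ℂ → ℂ} (hg : DifferentiableOn ℂ g U) :
    IsSubharmonicOn
      (fun z => ENNReal.log (spectralRadius ℂ (NormedSpace.exp (-(A + g z • B))))) U := by
  have hf : DifferentiableOn ℂ (fun z => NormedSpace.exp (-(A + g z • B))) U := by
    intro z hz
    have h1 : DifferentiableWithinAt ℂ (fun z => -(A + g z • B)) U z :=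
      ((differentiableWithinAt_const A).add ((hg z hz).smul_const B)).neg
    exact ((NormedSpace.exp_analytic (𝕂 := ℂ) (-(A + g z • B))).differentiableAt).comp_differentiableWithinAt z h1
  exact Ransford1995_thm_6_4_2_holds (Matrix m m ℂ) U _ hU hf

/-- **Lower bound by eigenvalues**: for every `λ ∈ σ(A + wB)` one has
`-Re λ ≤ log ρ(exp(-(A + wB)))` (`e^{-λ} ∈ σ(exp(-(A + wB)))`, Mathlib's `spectrum.exp_mem_exp`).
[folklore] -/
theorem neg_re_le_log_spectralRadius_exp (A B : Matrix m m ℂ) (w : ℂ) {lam : ℂ}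
    (hlam : lam ∈ spectrum ℂ (A + w • B)) :
    ((-lam.re : ℝ) : EReal) ≤ ENNReal.log (spectralRadius ℂ (NormedSpace.exp (-(A + w • B)))) := by
  have hneg : -lam ∈ spectrum ℂ (-(A + w • B)) := by
    rw [← spectrum.neg_eq]; exact Set.neg_mem_neg.mpr hlam
  have hexp := spectrum.exp_mem_exp (𝕜 := ℂ) (-(A + w • B)) hneg
  have hle : (‖NormedSpace.exp (-lam)‖₊ : ℝ≥0∞) ≤
      spectralRadius ℂ (NormedSpace.exp (-(A + w • B))) :=
    le_iSup₂ (f := fun k (_ : k ∈ spectrum ℂ (NormedSpace.exp (-(A + w • B)))) => (‖k‖₊ : ℝ≥0∞))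
      (NormedSpace.exp (-lam)) hexp
  refine le_trans ?_ (ENNReal.log_monotone hle)
  have hnorm : ‖NormedSpace.exp (-lam)‖ = Real.exp (-lam.re) := by
    rw [← congr_fun Complex.exp_eq_exp_ℂ (-lam), Complex.norm_exp, Complex.neg_re]
  rw [← enorm_eq_nnnorm, ← ofReal_norm, hnorm, ENNReal.log_ofReal_of_pos (Real.exp_pos _),
    Real.log_exp]

/-- **Upper bound by the spectral abscissa**: if every `λ ∈ σ(A + wB)` has `t ≤ Re λ`, then
`log ρ(exp(-(A + wB))) ≤ -t` (every point of `σ(exp(-(A+wB)))` is `e^{-λ}` with `λ ∈ σ(A + wB)`,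
`spectrum_exp_subset_exp_spectrum`). [folklore] -/
theorem log_spectralRadius_exp_le (A B : Matrix m m ℂ) (w : ℂ) (t : ℝ)
    (ht : ∀ lam ∈ spectrum ℂ (A + w • B), t ≤ lam.re) :
    ENNReal.log (spectralRadius ℂ (NormedSpace.exp (-(A + w • B)))) ≤ ((-t : ℝ) : EReal) := by
  have hle : spectralRadius ℂ (NormedSpace.exp (-(A + w • B))) ≤ ENNReal.ofReal (Real.exp (-t)) := by
    refine iSup₂_le fun μ hμ => ?_
    obtain ⟨lam', hlam', rfl⟩ := spectrum_exp_subset_exp_spectrum (-(A + w • B)) μ hμ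
    have hlam : -lam' ∈ spectrum ℂ (A + w • B) := by
      rw [← spectrum.neg_eq] at hlam'
      simpa using Set.neg_mem_neg.mpr hlam'
    have h1 : t ≤ -lam'.re := by simpa using ht _ hlam
    have hnorm : ‖NormedSpace.exp lam'‖ = Real.exp lam'.re := by
      rw [← congr_fun Complex.exp_eq_exp_ℂ lam', Complex.norm_exp]
    rw [← enorm_eq_nnnorm, ← ofReal_norm, hnorm]
    exact ENNReal.ofReal_le_ofReal (Real.exp_le_exp.mpr (by linarith))
  refine (ENNReal.log_monotone hle).trans_eq ?_
  rw [ENNReal.log_ofReal_of_pos (Real.exp_pos _), Real.log_exp]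

/-- The quantity `log ρ(exp(-(A + wB)))` is a real number (neither `-∞` nor `+∞`) as soon as the
index type is nonempty. [folklore] -/
theorem log_spectralRadius_exp_ne_bot_top [Nonempty m] (A B : Matrix m m ℂ) (w : ℂ) :
    ENNReal.log (spectralRadius ℂ (NormedSpace.exp (-(A + w • B)))) ≠ ⊥ ∧
      ENNReal.log (spectralRadius ℂ (NormedSpace.exp (-(A + w • B)))) ≠ ⊤ := by
  obtain ⟨lam, hlam⟩ := spectrum.nonempty (A + w • B)
  constructor
  · intro h
    have := neg_re_le_log_spectralRadius_exp A B w hlam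
    rw [h, le_bot_iff] at this
    exact EReal.coe_ne_bot _ this
  · rw [Ne, ENNReal.log_eq_top_iff]
    exact ((spectrum.spectralRadius_le_nnnorm (𝕜 := ℂ) (NormedSpace.exp (-(A + w • B)))).trans_lt
      ENNReal.coe_lt_top).ne

end Literature.Analysis.Matrix
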